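import Literature.NumberTheory.LFunctions.WeilCombAutocorrelation
import HarnessLib

/-!
# The prime-side functional of a `ζ`-mollified comb in node form

Topic `Literature/NumberTheory/LFunctions`.  For the comb `g` of
`Literature/NumberTheory/LFunctions/WeilCombAutocorrelation.lean` (real resonator `α` on `[1, L]`,
real bump `b` supported in `[-1, 1]`, window `h = κ/M ≤ 1/2`) and any real weight `f`, the prime-side
functional `P_f(K) = ∑ₙ f(n) n^{-1/2} (K(log n) + K(-log n))` of `K = g ⋆ g̃` is the finite real sum
`2 (κ/M) ∑_{ℓ,ℓ' ≤ L} α_ℓ α_ℓ' ∑_{n ≤ N} f(n) V_{ℓℓ'}(n)` (`N ≥ 3LM`) over the NODE WEIGHTS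
`V_{ℓℓ'}(n) = ∑_{k' ≤ M} k'^{-1/2} n^{-1/2} ∑_{k ≤ M} k^{-1/2} B((log(nℓ'k'/ℓ) - log k)/h)` evaluated in
`Literature/NumberTheory/LFunctions/WeilCombNodeWeightsNode.lean`, and `‖g‖₂² = (κ/M) ∑ α_ℓ α_ℓ' V_{ℓℓ'}(1)`:

* `comb_kernel_node_eq` — the inner double sum at `y = log n` is `√n · V_{ℓℓ'}(n)`;
* `comb_kernel_even`, `comb_kernel_eq_zero` — `K(-y) = K(y)`, and `K(log n) = 0` for `n ≥ 3LM`;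
* `comb_prime_sum_re` — the displayed node form of `Re P_f(K)`;
* `comb_norm_sq` — the displayed node form of `‖g‖₂²`.

Everything is proved; no named facts.
-/

noncomputable section

open MeasureTheory Set Complex Finset
open scoped ComplexConjugate

namespace Literature.NumberTheory.LFunctions

section NodeForm

variable {α : ℕ → ℝ} {L : ℕ} {b : ℝ → ℝ} {M : ℕ} {κ : ℝ}

/-- **The inner double sum at a node.** For `n, ℓ, ℓ' ≥ 1` and `κ, M > 0`,
`∑_{k,k' ≤ M} B((log n + log(ℓ'k') - log(ℓk)) M/κ)/(√k √k') = √n · V_{ℓℓ'}(n)`. [folklore] -/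
theorem comb_kernel_node_eq (B : ℝ → ℝ) (M : ℕ) (κ : ℝ) {n ℓ ℓ' : ℕ} (hn : 1 ≤ n)
    (hℓ : 1 ≤ ℓ) (hℓ' : 1 ≤ ℓ') :
    ∑ k ∈ Finset.Icc 1 M, ∑ k' ∈ Finset.Icc 1 M,
        B ((Real.log n + Real.log ((ℓ' : ℝ) * k') - Real.log ((ℓ : ℝ) * k)) * (M : ℝ) / κ)
          / (Real.sqrt k * Real.sqrt k')
      = Real.sqrt n * ∑ k' ∈ Finset.Icc 1 M,
          (∑ k ∈ Finset.Icc 1 M, B ((Real.log ((n : ℝ) * ℓ' * k' / ℓ) - Real.log k) / (κ / M)) / Real.sqrt k)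
            / Real.sqrt k' / Real.sqrt n := by
  have hnR : (0 : ℝ) < n := by exact_mod_cast hn
  have hℓR : (0 : ℝ) < ℓ := by exact_mod_cast hℓ
  have hℓ'R : (0 : ℝ) < ℓ' := by exact_mod_cast hℓ'
  have hsn : Real.sqrt (n : ℝ) ≠ 0 := (Real.sqrt_pos.2 hnR).ne'
  rw [Finset.sum_comm, Finset.mul_sum]
  refine Finset.sum_congr rfl fun k' hk' ↦ ?_
  have hk'R : (0 : ℝ) < k' := by exact_mod_cast (Finset.mem_Icc.1 hk').1
  rw [← mul_div_assoc, mul_div_cancel_left₀ _ hsn, Finset.sum_div]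
  refine Finset.sum_congr rfl fun k hk ↦ ?_
  have hkR : (0 : ℝ) < k := by exact_mod_cast (Finset.mem_Icc.1 hk).1
  have harg : (Real.log n + Real.log ((ℓ' : ℝ) * k') - Real.log ((ℓ : ℝ) * k)) * (M : ℝ) / κ
      = (Real.log ((n : ℝ) * ℓ' * k' / ℓ) - Real.log k) / (κ / M) := by
    rw [Real.log_mul hℓ'R.ne' hk'R.ne', Real.log_mul hℓR.ne' hkR.ne',
      Real.log_div (by positivity) hℓR.ne', Real.log_mul (by positivity) hk'R.ne',
      Real.log_mul hnR.ne' hℓ'R.ne', div_div_eq_mul_div]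
    ring
  rw [harg, div_div]

/-- **The kernel is even**: swapping `(ℓ,k) ↔ (ℓ',k')` and using `B(-v) = B(v)`. [folklore] -/
theorem comb_kernel_even {B : ℝ → ℝ} (hBe : ∀ v, B (-v) = B v) (α : ℕ → ℝ) (L M : ℕ) (κ y : ℝ) :
    ∑ ℓ ∈ Finset.Icc 1 L, ∑ ℓ' ∈ Finset.Icc 1 L, α ℓ * α ℓ' *
        ∑ k ∈ Finset.Icc 1 M, ∑ k' ∈ Finset.Icc 1 M,
          B ((-y + Real.log ((ℓ' : ℝ) * k') - Real.log ((ℓ : ℝ) * k)) * (M : ℝ) / κ)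
            / (Real.sqrt k * Real.sqrt k')
      = ∑ ℓ ∈ Finset.Icc 1 L, ∑ ℓ' ∈ Finset.Icc 1 L, α ℓ * α ℓ' *
        ∑ k ∈ Finset.Icc 1 M, ∑ k' ∈ Finset.Icc 1 M,
          B ((y + Real.log ((ℓ' : ℝ) * k') - Real.log ((ℓ : ℝ) * k)) * (M : ℝ) / κ)
            / (Real.sqrt k * Real.sqrt k') := by
  rw [Finset.sum_comm]
  refine Finset.sum_congr rfl fun ℓ _ ↦ Finset.sum_congr rfl fun ℓ' _ ↦ ?_
  rw [mul_comm (α ℓ') (α ℓ), Finset.sum_comm]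
  congr 1
  refine Finset.sum_congr rfl fun k _ ↦ Finset.sum_congr rfl fun k' _ ↦ ?_
  rw [← hBe, mul_comm (Real.sqrt (k' : ℝ))]
  congr 2
  ring

/-- **The kernel vanishes beyond the nodes `n < 3LM`**: if `B(v) = 0` for `|v| > 2`, `κ/M ≤ 1/2`
and `n ≥ 3LM ≥ 1`, every term of the kernel at `y = log n` vanishes. [folklore] -/
theorem comb_kernel_eq_zero {B : ℝ → ℝ} (hBs : ∀ x, 2 < |x| → B x = 0) (α : ℕ → ℝ)
    (hM : 0 < M) (hκ : 0 < κ) (hκM : κ / M ≤ 1 / 2) {n : ℕ} (hL : 1 ≤ L) (hn : 3 * L * M ≤ n) :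
    ∑ ℓ ∈ Finset.Icc 1 L, ∑ ℓ' ∈ Finset.Icc 1 L, α ℓ * α ℓ' *
        ∑ k ∈ Finset.Icc 1 M, ∑ k' ∈ Finset.Icc 1 M,
          B ((Real.log n + Real.log ((ℓ' : ℝ) * k') - Real.log ((ℓ : ℝ) * k)) * (M : ℝ) / κ)
            / (Real.sqrt k * Real.sqrt k') = 0 := by
  have hMR : (0 : ℝ) < M := by exact_mod_cast hM
  have hLR : (1 : ℝ) ≤ L := by exact_mod_cast hL
  have hnR : (3 : ℝ) * L * M ≤ n := by exact_mod_cast hn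
  have hn0 : (0 : ℝ) < n := lt_of_lt_of_le (by positivity) hnR
  refine Finset.sum_eq_zero fun ℓ hℓ ↦ Finset.sum_eq_zero fun ℓ' hℓ' ↦ ?_
  rw [Finset.sum_eq_zero fun k hk ↦ Finset.sum_eq_zero fun k' hk' ↦ ?_, mul_zero]
  obtain ⟨hℓ1, hℓL⟩ := Finset.mem_Icc.1 hℓ
  obtain ⟨hℓ'1, -⟩ := Finset.mem_Icc.1 hℓ'
  obtain ⟨hk1, hkM⟩ := Finset.mem_Icc.1 hk
  obtain ⟨hk'1, -⟩ := Finset.mem_Icc.1 hk'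
  have hℓR : (1 : ℝ) ≤ ℓ := by exact_mod_cast hℓ1
  have hℓ'R : (1 : ℝ) ≤ ℓ' := by exact_mod_cast hℓ'1
  have hkR : (1 : ℝ) ≤ k := by exact_mod_cast hk1
  have hk'R : (1 : ℝ) ≤ k' := by exact_mod_cast hk'1
  have hℓk : (ℓ : ℝ) * k ≤ L * M := by
    have h1 : (ℓ : ℝ) ≤ L := by exact_mod_cast hℓL
    have h2 : (k : ℝ) ≤ M := by exact_mod_cast hkM
    exact mul_le_mul h1 h2 (by linarith) (by linarith)
  rw [hBs _ ?_, zero_div]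
  -- `log n - log(ℓk) ≥ log 3 > 2κ/M` and `log(ℓ'k') ≥ 0`
  have h1 : 0 ≤ Real.log ((ℓ' : ℝ) * k') := Real.log_nonneg (by nlinarith)
  have h2 : Real.log ((ℓ : ℝ) * k) + Real.log 3 ≤ Real.log n := by
    rw [← Real.log_mul (by positivity) (by norm_num)]
    exact Real.log_le_log (by positivity) (by nlinarith)
  have h3 : (1 : ℝ) < Real.log 3 := by
    rw [Real.lt_log_iff_exp_lt (by norm_num)]
    exact lt_trans Real.exp_one_lt_d9 (by norm_num)
  have h4 : 2 < (Real.log n + Real.log ((ℓ' : ℝ) * k') - Real.log ((ℓ : ℝ) * k)) * (M : ℝ) / κ := by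
    rw [lt_div_iff₀ hκ]
    have : 2 * κ ≤ 1 * M := by
      rw [div_le_iff₀ hMR] at hκM; linarith
    nlinarith
  exact lt_of_lt_of_le h4 (le_abs_self _)

/-- `(g ⋆ g̃)(0) = ‖g‖₂²` as a complex number. [folklore] -/
theorem weilConv_weilReflect_zero (g : ℝ → ℂ) :
    weilConv g (weilReflect g) 0 = ((∫ u, ‖g u‖ ^ 2 : ℝ) : ℂ) := by
  rw [weilConv_apply, ← integral_complex_ofReal]
  refine integral_congr_ae (Filter.Eventually.of_forall fun u ↦ ?_)
  simp only [weilReflect, zero_sub, neg_neg, Complex.mul_conj, Complex.normSq_eq_norm_sq]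

/-- Reorganisation of the node sum: `2 ∑ₙ wₙ (c ∑_{ℓ,ℓ'} a_ℓ a_ℓ' S) = 2c ∑_{ℓ,ℓ'} a_ℓ a_ℓ' ∑ₙ wₙ S`.
[folklore] -/
theorem sum_reorg (a w : ℕ → ℝ) (S : ℕ → ℕ → ℕ → ℝ) (c : ℝ) (sn sl : Finset ℕ) :
    2 * ∑ n ∈ sn, w n * (c * ∑ ℓ ∈ sl, ∑ ℓ' ∈ sl, a ℓ * a ℓ' * S n ℓ ℓ')
      = 2 * c * ∑ ℓ ∈ sl, ∑ ℓ' ∈ sl, a ℓ * a ℓ' * ∑ n ∈ sn, w n * S n ℓ ℓ' := by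
  simp only [Finset.mul_sum]
  rw [Finset.sum_comm]
  refine Finset.sum_congr rfl fun ℓ _ ↦ ?_
  rw [Finset.sum_comm]
  refine Finset.sum_congr rfl fun ℓ' _ ↦ Finset.sum_congr rfl fun n _ ↦ ?_
  ring

/-- **The prime-side functional in node form.** For the comb `g` (real resonator `α` on `[1,L]`,
`L ≥ 1`, continuous compactly supported real bump `b` with `tsupport b ⊆ [-1,1]`, `M, κ > 0`,
`κ/M ≤ 1/2`), any real weight `f` and `N ≥ 3LM`:
`Re ∑ₙ f(n) n^{-1/2} (K(log n) + K(-log n)) = 2(κ/M) ∑_{ℓ,ℓ' ≤ L} α_ℓ α_ℓ' ∑_{n ≤ N} f(n) V_{ℓℓ'}(n)`.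
[folklore] -/
theorem comb_prime_sum_re (hα : ∀ m, L < m → α m = 0) (hL : 1 ≤ L) (hb : Continuous b)
    (hbc : HasCompactSupport b) (hbs : tsupport b ⊆ Icc (-1) 1) (hM : 0 < M) (hκ : 0 < κ)
    (hκM : κ / M ≤ 1 / 2) (f : ℕ → ℝ) {N : ℕ} (hN : 3 * L * M ≤ N) (g : ℝ → ℂ)
    (hg : g = fun u ↦ ∑ m ∈ Finset.range (L * M + 1),
      ((∑ k ∈ (Nat.divisors m).filter (· ≤ M), α (m / k) / Real.sqrt k : ℝ) : ℂ) *
        ((b ((u - Real.log m) * (M : ℝ) / κ) : ℝ) : ℂ)) :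
    (∑' n : ℕ, ((f n : ℝ) : ℂ) / (Real.sqrt n : ℂ) *
        (weilConv g (weilReflect g) (Real.log n) + weilConv g (weilReflect g) (-Real.log n))).re
      = 2 * (κ / M) * ∑ ℓ ∈ Finset.Icc 1 L, ∑ ℓ' ∈ Finset.Icc 1 L, α ℓ * α ℓ' *
          ∑ n ∈ Finset.Icc 1 N, f n *
            ∑ k' ∈ Finset.Icc 1 M,
              (∑ k ∈ Finset.Icc 1 M, (∫ u, b u * b (u - (Real.log ((n : ℝ) * ℓ' * k' / ℓ) - Real.log k) / (κ / M)))
                  / Real.sqrt k) / Real.sqrt k' / Real.sqrt n := by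
  -- the kernel
  set Kr : ℝ → ℝ := fun y ↦ κ / M * ∑ ℓ ∈ Finset.Icc 1 L, ∑ ℓ' ∈ Finset.Icc 1 L, α ℓ * α ℓ' *
    ∑ k ∈ Finset.Icc 1 M, ∑ k' ∈ Finset.Icc 1 M,
      (∫ s, b s * b (s - (y + Real.log ((ℓ' : ℝ) * k') - Real.log ((ℓ : ℝ) * k)) * (M : ℝ) / κ))
        / (Real.sqrt k * Real.sqrt k') with hKr
  have hK : ∀ y, weilConv g (weilReflect g) y = ((Kr y : ℝ) : ℂ) := by
    intro y; rw [hg]; exact weilConv_comb_eq hα hb hbc hM hκ y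
  have hBs : ∀ x, 2 < |x| → (∫ u, b u * b (u - x)) = 0 := fun x hx ↦ autocorr_eq_zero hbs hx
  have hBe : ∀ v, (∫ u, b u * b (u - -v)) = ∫ u, b u * b (u - v) := fun v ↦ autocorr_neg b v
  have heven : ∀ y, Kr (-y) = Kr y := by
    intro y
    simp only [hKr]
    rw [comb_kernel_even (B := fun v ↦ ∫ u, b u * b (u - v)) hBe α L M κ y]
  have hzero : ∀ n : ℕ, 3 * L * M ≤ n → Kr (Real.log n) = 0 := by
    intro n hn
    simp only [hKr]
    rw [comb_kernel_eq_zero (B := fun v ↦ ∫ u, b u * b (u - v)) hBs α hM hκ hκM hL hn, mul_zero]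
  -- reduce the series to a finite sum
  rw [tsum_eq_sum (s := Finset.Icc 1 N) (fun n hn ↦ ?_)]
  · rw [Complex.re_sum]
    have hterm : ∀ n ∈ Finset.Icc 1 N, (((f n : ℝ) : ℂ) / (Real.sqrt n : ℂ) *
        (weilConv g (weilReflect g) (Real.log n) + weilConv g (weilReflect g) (-Real.log n))).re
        = 2 * (f n / Real.sqrt n * Kr (Real.log n)) := by
      intro n hn
      rw [hK, hK, heven]
      have : ((f n : ℝ) : ℂ) / (Real.sqrt n : ℂ) * ((Kr (Real.log n) : ℂ) + (Kr (Real.log n) : ℂ))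
          = ((2 * (f n / Real.sqrt n * Kr (Real.log n)) : ℝ) : ℂ) := by push_cast; ring
      rw [this, Complex.ofReal_re]
    rw [Finset.sum_congr rfl hterm, ← Finset.mul_sum]
    -- reorganise
    simp only [hKr]
    have hnode : ∀ n ∈ Finset.Icc 1 N, ∀ ℓ ∈ Finset.Icc 1 L, ∀ ℓ' ∈ Finset.Icc 1 L,
        f n / Real.sqrt n * ∑ k ∈ Finset.Icc 1 M, ∑ k' ∈ Finset.Icc 1 M,
          (∫ s, b s * b (s - (Real.log n + Real.log ((ℓ' : ℝ) * k') - Real.log ((ℓ : ℝ) * k)) * (M : ℝ) / κ))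
            / (Real.sqrt k * Real.sqrt k')
        = f n * ∑ k' ∈ Finset.Icc 1 M,
              (∑ k ∈ Finset.Icc 1 M, (∫ u, b u * b (u - (Real.log ((n : ℝ) * ℓ' * k' / ℓ) - Real.log k) / (κ / M)))
                  / Real.sqrt k) / Real.sqrt k' / Real.sqrt n := by
      intro n hn ℓ hℓ ℓ' hℓ'
      have hn1 := (Finset.mem_Icc.1 hn).1
      have hsn : Real.sqrt (n : ℝ) ≠ 0 := (Real.sqrt_pos.2 (by exact_mod_cast hn1)).ne'
      rw [comb_kernel_node_eq (fun v ↦ ∫ u, b u * b (u - v)) M κ hn1 (Finset.mem_Icc.1 hℓ).1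
        (Finset.mem_Icc.1 hℓ').1, ← mul_assoc, div_mul_cancel₀ _ hsn]
    have hR : 2 * (κ / M) * ∑ ℓ ∈ Finset.Icc 1 L, ∑ ℓ' ∈ Finset.Icc 1 L, α ℓ * α ℓ' *
          ∑ n ∈ Finset.Icc 1 N, f n *
            ∑ k' ∈ Finset.Icc 1 M,
              (∑ k ∈ Finset.Icc 1 M, (∫ u, b u * b (u - (Real.log ((n : ℝ) * ℓ' * k' / ℓ) - Real.log k) / (κ / M)))
                  / Real.sqrt k) / Real.sqrt k' / Real.sqrt n
        = 2 * (κ / M) * ∑ ℓ ∈ Finset.Icc 1 L, ∑ ℓ' ∈ Finset.Icc 1 L, α ℓ * α ℓ' *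
          ∑ n ∈ Finset.Icc 1 N, f n / Real.sqrt n * ∑ k ∈ Finset.Icc 1 M, ∑ k' ∈ Finset.Icc 1 M,
            (∫ s, b s * b (s - (Real.log n + Real.log ((ℓ' : ℝ) * k') - Real.log ((ℓ : ℝ) * k)) * (M : ℝ) / κ))
              / (Real.sqrt k * Real.sqrt k') := by
      congr 1
      refine Finset.sum_congr rfl fun ℓ hℓ ↦ Finset.sum_congr rfl fun ℓ' hℓ' ↦ ?_
      congr 1
      exact Finset.sum_congr rfl fun n hn ↦ (hnode n hn ℓ hℓ ℓ' hℓ').symm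
    rw [hR]
    exact sum_reorg α (fun n ↦ f n / Real.sqrt n) (fun n ℓ ℓ' ↦ ∑ k ∈ Finset.Icc 1 M, ∑ k' ∈ Finset.Icc 1 M,
      (∫ s, b s * b (s - (Real.log n + Real.log ((ℓ' : ℝ) * k') - Real.log ((ℓ : ℝ) * k)) * (M : ℝ) / κ))
        / (Real.sqrt k * Real.sqrt k')) (κ / M) (Finset.Icc 1 N) (Finset.Icc 1 L)
  · -- terms outside `1 ≤ n ≤ N` vanish
    simp only [Finset.mem_Icc, not_and_or, not_le] at hn
    rcases hn with hn | hn
    · have : n = 0 := by omega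
      subst this
      simp
    · have hn' : 3 * L * M ≤ n := le_trans hN hn.le
      rw [hK, hK, heven, hzero n hn']
      simp

/-- **The norm in node form**: `‖g‖₂² = (κ/M) ∑_{ℓ,ℓ' ≤ L} α_ℓ α_ℓ' V_{ℓℓ'}(1)`. [folklore] -/
theorem comb_norm_sq (hα : ∀ m, L < m → α m = 0) (hb : Continuous b) (hbc : HasCompactSupport b)
    (hM : 0 < M) (hκ : 0 < κ) (g : ℝ → ℂ)
    (hg : g = fun u ↦ ∑ m ∈ Finset.range (L * M + 1),
      ((∑ k ∈ (Nat.divisors m).filter (· ≤ M), α (m / k) / Real.sqrt k : ℝ) : ℂ) *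
        ((b ((u - Real.log m) * (M : ℝ) / κ) : ℝ) : ℂ)) :
    ∫ u, ‖g u‖ ^ 2 = κ / M * ∑ ℓ ∈ Finset.Icc 1 L, ∑ ℓ' ∈ Finset.Icc 1 L, α ℓ * α ℓ' *
        ∑ k' ∈ Finset.Icc 1 M,
          (∑ k ∈ Finset.Icc 1 M, (∫ u, b u * b (u - (Real.log (((1 : ℕ) : ℝ) * ℓ' * k' / ℓ) - Real.log k) / (κ / M)))
              / Real.sqrt k) / Real.sqrt k' / Real.sqrt ((1 : ℕ) : ℝ) := by
  have h1 := weilConv_weilReflect_zero g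
  have h2 := weilConv_comb_eq hα hb hbc hM hκ (0 : ℝ)
  rw [← hg, h1] at h2
  have h3 := Complex.ofReal_injective h2
  rw [h3]
  congr 1
  refine Finset.sum_congr rfl fun ℓ hℓ ↦ Finset.sum_congr rfl fun ℓ' hℓ' ↦ ?_
  congr 1
  have := comb_kernel_node_eq (fun v ↦ ∫ u, b u * b (u - v)) M κ (n := 1) le_rfl
    (Finset.mem_Icc.1 hℓ).1 (Finset.mem_Icc.1 hℓ').1
  simp only [Nat.cast_one, Real.log_one, Real.sqrt_one, one_mul] at this ⊢
  simpa only [zero_add] using this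

end NodeForm

/-! ## The two-point design `δ₁ + δ_p` -/

/-- For `p ≥ 2`: `∑_{ℓ ≤ p} 𝟙[ℓ ∈ {1,p}] G(ℓ) = G(1) + G(p)`. [folklore] -/
theorem sum_design_one {p : ℕ} (hp : 2 ≤ p) (G : ℕ → ℝ) :
    ∑ ℓ ∈ Finset.Icc 1 p, (if ℓ = 1 ∨ ℓ = p then (1 : ℝ) else 0) * G ℓ = G 1 + G p := by
  have hfilter : (Finset.Icc 1 p).filter (fun ℓ ↦ ℓ = 1 ∨ ℓ = p) = {1, p} := by
    ext ℓ
    simp only [Finset.mem_filter, Finset.mem_Icc, Finset.mem_insert, Finset.mem_singleton]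
    omega
  rw [← Finset.sum_filter_of_ne (p := fun ℓ ↦ ℓ = 1 ∨ ℓ = p) (fun ℓ _ hne ↦ by
    by_contra hcon; exact hne (by rw [if_neg hcon, zero_mul])), hfilter,
    Finset.sum_pair (by omega : (1 : ℕ) ≠ p)]
  simp

/-- **The two-point design**: with `α = 𝟙_{{1,p}}` (`p ≥ 2`),
`∑_{ℓ,ℓ' ≤ p} α_ℓ α_ℓ' F(ℓ,ℓ') = F(1,1) + F(1,p) + F(p,1) + F(p,p)`. [folklore] -/
theorem sum_design_two {p : ℕ} (hp : 2 ≤ p) (F : ℕ → ℕ → ℝ) :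
    ∑ ℓ ∈ Finset.Icc 1 p, ∑ ℓ' ∈ Finset.Icc 1 p,
        (if ℓ = 1 ∨ ℓ = p then (1 : ℝ) else 0) * (if ℓ' = 1 ∨ ℓ' = p then (1 : ℝ) else 0) * F ℓ ℓ'
      = F 1 1 + F 1 p + F p 1 + F p p := by
  have inner : ∀ ℓ : ℕ, ∑ ℓ' ∈ Finset.Icc 1 p,
      (if ℓ = 1 ∨ ℓ = p then (1 : ℝ) else 0) * (if ℓ' = 1 ∨ ℓ' = p then (1 : ℝ) else 0) * F ℓ ℓ'
      = (if ℓ = 1 ∨ ℓ = p then (1 : ℝ) else 0) * (F ℓ 1 + F ℓ p) := by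
    intro ℓ
    rw [← sum_design_one hp (F ℓ), Finset.mul_sum]
    refine Finset.sum_congr rfl fun ℓ' _ ↦ by ring
  simp_rw [inner]
  rw [sum_design_one hp]
  ring

end Literature.NumberTheory.LFunctions
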